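import Summits.CriticalPhenomena.Ising3DConformalLimit.Theorems.HyperoctahedralRPExistsScaleCovariantLimitBlockDefs
import Literature.Probability.LatticeModels.CriticalUrsellFourSign
import HarnessLib

/-!
# Conjecture BM at odd orders is trivial: the content of `stub_monotoneBlockingHigher` is even `n ≥ 4`
(line `monotone-blocking-port` of the crux `ExistsScaleCovariantLimit`, item stmt-CriticalPhenomena-1981; lead
prover-line-stmt-CriticalPhenomena-1981-a1-0, 2026-08-16; registered sub-goal `monotoneBlockingHigher_odd`)

The registered research stub S2 `stub_monotoneBlockingHigher` asks that for every `n ≥ 3` and every injective offset vector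
`k⃗ ∈ (ℤ³)ⁿ` the normalised block moment `L ↦ R_n(L;k⃗)` (`critBlockMoment n L k`) be eventually monotone. At ODD orders the
critical correlators of the nearest-neighbour Ising model on `ℤ³` vanish identically (`criticalCorr_eq_zero_of_odd`: spin flip and
`m*(β_c) = 0`), so `R_n(L;k⃗) = 0` for every `L` and the sequence is constant, hence monotone from `L₀ = 0`:
`monotoneBlockingHigher_odd`. What remains of S2 is exactly the even orders `n = 2m ≥ 4` (`monotoneBlockingHigher_iff_even`), i.e.
the conjecture that the approach of every even block moment to its limit is eventually one-signed.

References: crux idea card `Ideas/monotone-blocking-port.md` (conjecture BM); Aizenman–Duminil-Copin–Sidoravicius, CMP 334 (2015)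
(continuity of the magnetisation at `β_c`, behind `criticalCorr_eq_zero_of_odd`). No definitions, no `sorry`.
-/

noncomputable section

namespace Summit.CriticalPhenomena.Ising3DConformalLimit.Cruxes.ExistsScaleCovariantLimit.MonotoneBlockingPort

open Literature.Probability.LatticeModels Filter Set
open scoped Topology BigOperators

/-- At odd orders every normalised block moment vanishes: `R_n(L; k⃗) = 0` (odd critical correlators vanish on `ℤ³`). [folklore] -/
theorem critBlockMoment_eq_zero_of_odd {n : ℕ} (hn : Odd n) (L : ℕ) (k : Fin n → Site 3) :
    critBlockMoment n L k = 0 := by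
  unfold critBlockMoment
  rw [Finset.sum_eq_zero fun x _ => criticalCorr_eq_zero_of_odd (d := 3) le_rfl hn _, zero_div]

/-- **Conjecture BM at odd orders `n ≥ 3` holds trivially** (constant zero sequences are monotone): the registered stub
`stub_monotoneBlockingHigher` restricted to odd `n`. [folklore] -/
theorem monotoneBlockingHigher_odd :
    ∀ n : ℕ, 3 ≤ n → Odd n → ∀ k : Fin n → Site 3, Function.Injective k → ∃ L₀ : ℕ,
      MonotoneOn (fun L : ℕ => critBlockMoment n L k) (Set.Ici L₀) ∨
        AntitoneOn (fun L : ℕ => critBlockMoment n L k) (Set.Ici L₀) := by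
  intro n _ hn k _
  refine ⟨0, Or.inl ?_⟩
  intro a _ b _ _
  simp only [critBlockMoment_eq_zero_of_odd hn]
  exact le_rfl

/-- **What S2 really asks**: `Sig.stub_monotoneBlockingHigher` is equivalent to its restriction to EVEN orders `n ≥ 4`. [folklore] -/
theorem monotoneBlockingHigher_iff_even :
    Sig.stub_monotoneBlockingHigher ↔
      ∀ n : ℕ, 4 ≤ n → Even n → ∀ k : Fin n → Site 3, Function.Injective k → ∃ L₀ : ℕ,
        MonotoneOn (fun L : ℕ => critBlockMoment n L k) (Set.Ici L₀) ∨
          AntitoneOn (fun L : ℕ => critBlockMoment n L k) (Set.Ici L₀) := by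
  constructor
  · intro h n hn _ k hk
    exact h n (by omega) k hk
  · intro h n hn k hk
    rcases Nat.even_or_odd n with he | ho
    · have h4 : 4 ≤ n := by
        obtain ⟨m, rfl⟩ := he
        omega
      exact h n h4 he k hk
    · exact monotoneBlockingHigher_odd n hn ho k hk

end Summit.CriticalPhenomena.Ising3DConformalLimit.Cruxes.ExistsScaleCovariantLimit.MonotoneBlockingPort

end
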